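/-
Copyright (c) 2026 the pub-hodgecm-mathlib formalisation cell (harness21).  Prover seat hodgecm-mathlib-K2E3-p24 (g0), Track B «K2-LIT» ∕ h413
(`stmt-HodgeConjecture-24833`), line `K2_E3_EllipticInputs`, road (11-3-split-nsc), leaf (nsc-S-C′) `sig_K2E3GL3TwoBlockCuspidalSupportCharLocInt`,
brick (vD-σ-MU-GL): «integrating out `U_c`» on `P_c = M_c U_c ⊆ GL_N(F)` — the `GL_N` discharge of ★ (vD-σ-MU).  2026-09-04.
-/
import Summits.HodgeConjecture.HodgeConjecture.Theorems.K2E3InflatedCharacterLeviUnipotent    -- ★ (vD-σ-MU) p858728 (K2E3-p24 g0): `smoothTrace_eq_smoothTrace_fibreIntegral`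
import Summits.HodgeConjecture.HodgeConjecture.Theorems.K2E3ParabolicIndCharacterGeneral      -- ★ (vD-σ-GL) p858696 (K2E3-p24 g0): `isOpenMap_leviProjection`, frame imports
import Literature.NumberTheory.Automorphic.GLnTwoBlockLeviStructure                           -- ★ `exists_homeomorph_levi_prod_unipotent_coe_eq` (`M_c × U_c ≃ₜ P_c`)
import Literature.NumberTheory.Automorphic.GLnStandardLeviUnimodular                          -- ★ `isClosed_standardLeviGL`
import Literature.NumberTheory.Automorphic.UnipotentRadicalCompactOpenProofs                  -- ★ `isClosed_unipotentRadicalGL`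
import Literature.NumberTheory.Automorphic.GLnParabolicIntegralLeviUnipotent                  -- ★ `rootDeltaChar_eq_one_of_mem_unipotentRadicalP` (via import)
import Mathlib.MeasureTheory.Measure.Haar.Basic
import HarnessLib

/-!
# K2_E3 road (h413), leaf (nsc-S-C′), brick (vD-σ-MU-GL) — for `σ_P = (σ ∘ proj) ⊗ δ^{1∕2}` on `P_c ⊆ GL_N(F)` and a test function `F` on `P_c` with level
# `P_c ∩ K₁`: `tr σ_P(F dμ_P) = tr σ_M(F̄ dν_M)`, `F̄(m) = ∫_{U_c} F(mu) dμ_U`, `σ_M = σ_P|_{M_c}` — and `F̄` is a test function on `M_c`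

Cell `pub/hodgecm-mathlib` (D-0151), Track B, seat K2E3-p24 (g0) = hand of the hosted leaf (nsc-S-C′) (road owner K2E3-p11 (g6)).
`--supports stmt-HodgeConjecture-24833 --as helper`; THEOREMS ONLY (no definition ∕ instance ∕ notation ∕ named fact ∕ `sorry`); never imports `Cruxes/…/Lines`.
COUNT-NEUTRAL.

THE MATHEMATICS ([vanDijk1972, proof of Thm. p. 237]; [BernsteinZelevinsky1977, §1.8, §2.1, §2.3]).  The hypotheses of the generic brick ★ (vD-σ-MU)
`smoothTrace_eq_smoothTrace_fibreIntegral` are discharged for `G = GL_N(F)`, `P = P_c ⊇ M_c, U_c` (any monotone block labelling `c`), `τ = σ_P` with `σ`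
admissible, and a compact open subgroup `K₁ ≤ GL_N(F)` such that `F` is bi-invariant under `P_c ∩ K₁`:
* §1 `integral_comp_conj_eq_of_mem` (generic locally compact group): a Haar measure on a closed subgroup `U` is invariant under `u ↦ m u m⁻¹` for `m` in a compact
  open subgroup `K₁` normalising `U ∩ K₁` (the image measure is a Haar measure giving `U ∩ K₁` the same mass; Haar uniqueness, Mathlib `haarMeasure_unique`);
* §2 `isAdmissible_comp_inclusion_levi` — `σ_M = σ_P|_{M_c}` is admissible (`M_c ≃ₜ Π_a GL_{n_a}(F)` by `proj`, ★ `IsAdmissible.comp_of_isOpenMap`, ★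
  `IsAdmissible.twist`); `homeomorph_leviProjection_inclusion` (existence form);
* §3 **`GLn.smoothTrace_twist_comp_leviProjection_eq_fibreIntegral`** — the level `L := (P_c ∩ K₁) ∩ (blockdiag ∘ proj)⁻¹(K₁)` of `F` is of PRODUCT FORM by
  construction (`l = ℓ(l) · ℓ(l)⁻¹l`, ★ `leviEmbeddingP_inv_mul_mem_unipotentRadicalP`), `σ_P(U_c) = 1` (★ `rootDeltaChar_eq_one_of_mem_unipotentRadicalP`),
  `M_c` normalises `U_c`, `M_c × U_c ≃ₜ P_c` (★), and §1 gives the `Ad(L ∩ M_c)`-invariance of `μ_U`; conclusion: `F̄` is locally constant with compact support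
  and `tr σ_P(F dμ_P) = tr σ_M(F̄ dν_M)`.

HONEST LABEL: HC_CM is proved only modulo the 7 printed citations (2 remaining named inputs: hLiu418 = stmt-HodgeConjecture-24832, h413 =
stmt-HodgeConjecture-24833) until rung 0 closes; count-neutral helper.

## References
* [vanDijk1972] G. van Dijk, *Computation of certain induced characters of 𝔭-adic groups*, Math. Ann. 199 (1972), 229–240, Thm. p. 237.
* [BernsteinZelevinsky1977] I. N. Bernstein, A. V. Zelevinsky, *Induced representations of reductive 𝔭-adic groups I*, Ann. Sci. ÉNS 10 (1977), §1.8, §2.1, §2.3.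
-/

set_option autoImplicit false
set_option linter.dupNamespace false

noncomputable section

open MeasureTheory MeasureTheory.Measure Topology TopologicalSpace
open scoped MatrixGroups NNReal ENNReal

namespace Summit.HodgeConjecture.HodgeConjecture.Cruxes.H413.K2E3ParabolicCharacterLeviUnipotentGL

open Literature.NumberTheory.Automorphic Representation
open Literature.NumberTheory.GaloisRepresentations.IsNonarchimedeanLocalField
open Summit.HodgeConjecture.HodgeConjecture.Cruxes.H413.K2E3InflatedCharacterLeviUnipotent
open Summit.HodgeConjecture.HodgeConjecture.Cruxes.H413.K2E3ParabolicIndCharacterGeneral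

/-! ## §1  Haar measure on a closed subgroup is invariant under conjugation by a compact open subgroup normalising a level -/

section Conj

variable {G : Type*} [Group G] [TopologicalSpace G] [IsTopologicalGroup G]
  {U : Subgroup G} [MeasurableSpace ↥U] [BorelSpace ↥U]

/-- **`∫_U g(m u m⁻¹) dμ_U = ∫_U g dμ_U`** for a Haar measure `μ_U` on a closed subgroup `U` (second countable, locally compact), `m` an element of a compact open
subgroup `K₁ ≤ G` with `m U m⁻¹ = U`: the image of `μ_U` under the topological automorphism `u ↦ m u m⁻¹` is a Haar measure (Mathlib `MulEquiv.isHaarMeasure_map`)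
giving the compact open `U ∩ K₁` the same mass, hence equals `μ_U` (Mathlib `haarMeasure_unique`). [cite: BernsteinZelevinsky1977, §1.7] -/
theorem integral_comp_conj_eq_of_mem [T2Space G] [SecondCountableTopology ↥U] [LocallyCompactSpace ↥U] (μU : Measure ↥U) [μU.IsHaarMeasure]
    (hUcl : IsClosed (U : Set G)) {K₁ : Subgroup G} (hK₁o : IsOpen (K₁ : Set G)) (hK₁c : IsCompact (K₁ : Set G))
    {m : G} (hm : m ∈ K₁) (hmU : ∀ u : ↥U, m * (u : G) * m⁻¹ ∈ U) (hmU' : ∀ u : ↥U, m⁻¹ * (u : G) * m ∈ U) (g : ↥U → ℂ) :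
    ∫ u, g ⟨m * (u : G) * m⁻¹, hmU u⟩ ∂μU = ∫ u, g u ∂μU := by
  haveI : SigmaCompactSpace ↥U := sigmaCompactSpace_of_locallyCompact_secondCountable
  -- the conjugation automorphism of `U`
  let e : ↥U ≃* ↥U :=
    { toFun := fun u => ⟨m * (u : G) * m⁻¹, hmU u⟩
      invFun := fun u => ⟨m⁻¹ * (u : G) * m, hmU' u⟩
      left_inv := fun u => Subtype.ext (by simp only; group)
      right_inv := fun u => Subtype.ext (by simp only; group)
      map_mul' := fun u v => Subtype.ext (by simp only [Subgroup.coe_mul]; group) }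
  have hec : Continuous e := ((continuous_const.mul continuous_subtype_val).mul continuous_const).subtype_mk _
  have hesc : Continuous e.symm := ((continuous_const.mul continuous_subtype_val).mul continuous_const).subtype_mk _
  haveI : (Measure.map e μU).IsHaarMeasure := e.isHaarMeasure_map μU hec hesc
  -- the compact open `U ∩ K₁`, of the same mass for both measures
  have hK₀c : IsCompact (Subtype.val ⁻¹' (K₁ : Set G) : Set ↥U) := hUcl.isClosedEmbedding_subtypeVal.isCompact_preimage hK₁c
  have hK₀o : IsOpen (Subtype.val ⁻¹' (K₁ : Set G) : Set ↥U) := hK₁o.preimage continuous_subtype_val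
  let K₀ : PositiveCompacts ↥U := ⟨⟨_, hK₀c⟩, by rw [hK₀o.interior_eq]; exact ⟨1, by simp [K₁.one_mem]⟩⟩
  have hpre : e ⁻¹' (K₀ : Set ↥U) = K₀ := by
    ext u
    simp only [Set.mem_preimage]
    change m * (u : G) * m⁻¹ ∈ (K₁ : Set G) ↔ (u : G) ∈ (K₁ : Set G)
    simp only [SetLike.mem_coe]
    constructor
    · intro h
      have := K₁.mul_mem (K₁.mul_mem (K₁.inv_mem hm) h) hm
      simpa only [mul_assoc, inv_mul_cancel, mul_one, inv_mul_cancel_left] using this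
    · intro h
      exact K₁.mul_mem (K₁.mul_mem hm h) (K₁.inv_mem hm)
  have hmass : (Measure.map e μU) (K₀ : Set ↥U) = μU (K₀ : Set ↥U) := by
    rw [Measure.map_apply hec.measurable K₀.isCompact.measurableSet, hpre]
  have hmap : Measure.map e μU = μU := by
    rw [haarMeasure_unique (Measure.map e μU) K₀, hmass]
    exact (haarMeasure_unique μU K₀).symm
  -- change of variables
  let eₘ : ↥U ≃ᵐ ↥U := (Homeomorph.mk e.toEquiv hec hesc).toMeasurableEquiv
  have h := integral_map_equiv (μ := μU) eₘ g
  rw [show Measure.map eₘ μU = Measure.map e μU from rfl, hmap] at h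
  rw [h]
  rfl

end Conj

/-! ## §2  `σ_M = σ_P|_{M_c}` is admissible -/

section Levi

variable (F : Type*) [Field F] [ValuativeRel F] [TopologicalSpace F] [IsNonarchimedeanLocalField F]
  {n : Type*} [Fintype n] [DecidableEq n] {α : Type*} [LinearOrder α] [Fintype α] (c : n → α)

/-- **`M_c ≃ₜ Π_a GL_{n_a}(F)`** by `proj ∘ incl`, with inverse `m ↦ diag(m_a)` (existence form). [cite: BernsteinZelevinsky1977, §2.1] -/
theorem exists_homeomorph_leviProjection_inclusion :
    ∃ e : ↥(standardLeviGL F c) ≃ₜ (Π a, GL {i // c i = a} F),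
      ∀ m, e m = leviProjection F c (Subgroup.inclusion (standardLeviGL_le F c) m) := by
  haveI : IsTopologicalRing F := inferInstance
  refine ⟨{ toFun := fun m => leviProjection F c (Subgroup.inclusion (standardLeviGL_le F c) m)
            invFun := fun x => ⟨leviEmbedding F c x, ⟨x, rfl⟩⟩
            left_inv := fun m => ?_
            right_inv := fun x => ?_
            continuous_toFun := (continuous_leviProjection F c).comp (continuous_subtype_val.subtype_mk _)
            continuous_invFun := ?_ }, fun m => rfl⟩
  · obtain ⟨x, hx⟩ := m.2
    apply Subtype.ext
    simp only
    have hincl : Subgroup.inclusion (standardLeviGL_le F c) m = leviEmbeddingP F c x := Subtype.ext (by rw [Subgroup.coe_inclusion, ← hx]; rfl)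
    rw [hincl, leviProjection_leviEmbeddingP_apply, ← hx]
  · simp only
    have hincl : Subgroup.inclusion (standardLeviGL_le F c) ⟨leviEmbedding F c x, ⟨x, rfl⟩⟩ = leviEmbeddingP F c x := Subtype.ext rfl
    rw [hincl, leviProjection_leviEmbeddingP_apply]
  · exact ((continuous_subtype_val.comp (continuous_leviEmbeddingP F c))).subtype_mk _

variable {W : Type*} [AddCommGroup W] [Module ℂ W]

/-- **`σ_M := σ_P|_{M_c}` is admissible** for `σ` admissible: `σ_M = (σ ∘ (proj ∘ incl)) ⊗ (δ^{1∕2} ∘ incl)` with `proj ∘ incl : M_c → Π_a GL_{n_a}(F)` a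
homeomorphic isomorphism (★ `IsAdmissible.comp_of_isOpenMap`) and `δ^{1∕2}` smooth (★ `IsAdmissible.twist`, ★ `isOpen_ker_rootDeltaChar_standardParabolicGL`).
[cite: BernsteinZelevinsky1977, §1.8, Prop. 2.3] -/
theorem isAdmissible_comp_inclusion_levi {σ : Representation ℂ (Π a, GL {i // c i = a} F) W} (hσ : σ.IsAdmissible) :
    (Representation.twist (σ.comp ((leviProjection F c).comp (Subgroup.inclusion (standardLeviGL_le F c))))
      ((rootDeltaChar (standardParabolicGL F c)).comp (Subgroup.inclusion (standardLeviGL_le F c)))).IsAdmissible := by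
  haveI : IsTopologicalRing F := inferInstance
  obtain ⟨e, he⟩ := exists_homeomorph_leviProjection_inclusion F c
  have hΘc : Continuous ((leviProjection F c).comp (Subgroup.inclusion (standardLeviGL_le F c))) := by
    convert e.continuous using 1; funext m; exact (he m).symm
  have hΘo : IsOpenMap ((leviProjection F c).comp (Subgroup.inclusion (standardLeviGL_le F c))) := by
    convert e.isOpenMap using 1; funext m; exact (he m).symm
  have h1 : Representation.IsAdmissible (σ.comp ((leviProjection F c).comp (Subgroup.inclusion (standardLeviGL_le F c)))) :=
    IsAdmissible.comp_of_isOpenMap σ _ hΘc hΘo hσ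
  have hic : Continuous (Subgroup.inclusion (standardLeviGL_le F c)) := continuous_induced_rng.2 continuous_subtype_val
  exact h1.twist ((isOpen_ker_rootDeltaChar_standardParabolicGL F c).preimage hic)

end Levi

/-! ## §3  `tr σ_P(F dμ_P) = tr σ_M(F̄ dν_M)` on `P_c = M_c U_c ⊆ GL_N(F)` -/

section Main

variable {F : Type} [Field F] [ValuativeRel F] [TopologicalSpace F] [IsNonarchimedeanLocalField F]
  {n : ℕ} {α : Type*} [LinearOrder α] [Fintype α] {c : Fin n → α}
  [MeasurableSpace (GL (Fin n) F)] [BorelSpace (GL (Fin n) F)]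
  {W : Type*} [AddCommGroup W] [Module ℂ W]

set_option maxHeartbeats 1600000 in
/-- **INTEGRATING OUT `U_c` on `GL_N(F)`.**  `σ` an admissible representation of the block Levi, `σ_P = (σ ∘ proj) ⊗ δ_{P_c}^{1∕2}` on `P_c`,
`σ_M = (σ ∘ proj|_{M_c}) ⊗ δ^{1∕2}|_{M_c}` on `M_c` (`= σ_P|_{M_c}`), Haar measures with `∫_{P_c} g dμ_P = ∫_{M_c} ∫_{U_c} g(mu) dμ_U dν_M` (`hPint`, ★
`GLn.exists_haar_parabolic_integral_eq_levi_unipotent`), `K₁ ≤ GL_N(F)` compact open and `F` a locally constant compactly supported function on `P_c` bi-invariant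
under `P_c ∩ K₁`.  Then `F̄(m) = ∫_{U_c} F(mu) dμ_U` is locally constant with compact support on `M_c`, and **`tr σ_P(F dμ_P) = tr σ_M(F̄ dν_M)`**
(★ (vD-σ-MU) at the product-form level `L = (P_c ∩ K₁) ∩ ℓ⁻¹(K₁)`, `ℓ = blockdiag ∘ proj`; §1, §2). [cite: vanDijk1972, Thm. p. 237] [cite: BernsteinZelevinsky1977, §1.8, §2.3] -/
theorem GLn.smoothTrace_twist_comp_leviProjection_eq_fibreIntegral
    (σ : Representation ℂ (Π a, GL {i : Fin n // c i = a} F) W) (hσ : σ.IsAdmissible)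
    (μP : Measure ↥(standardParabolicGL F c)) [μP.IsHaarMeasure] (νM : Measure ↥(standardLeviGL F c)) [νM.IsHaarMeasure]
    (μU : Measure ↥(unipotentRadicalGL F c)) [μU.IsHaarMeasure]
    (hPint : ∀ g : ↥(standardParabolicGL F c) → ℂ, Continuous g → HasCompactSupport g →
      ∫ p, g p ∂μP = ∫ m : ↥(standardLeviGL F c), ∫ u : ↥(unipotentRadicalGL F c),
        g ⟨(m : GL (Fin n) F) * (u : GL (Fin n) F), (standardParabolicGL F c).mul_mem (standardLeviGL_le F c m.2) (unipotentRadicalGL_le F c u.2)⟩ ∂μU ∂νM)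
    {K₁ : Subgroup (GL (Fin n) F)} (hK₁o : IsOpen (K₁ : Set (GL (Fin n) F))) (hK₁c : IsCompact (K₁ : Set (GL (Fin n) F)))
    {Fn : ↥(standardParabolicGL F c) → ℂ} (hFlc : IsLocallyConstant Fn) (hFc : HasCompactSupport Fn)
    (hFK₁ : IsLevel (K₁.comap (standardParabolicGL F c).subtype) Fn) :
    IsLocallyConstant (fun m : ↥(standardLeviGL F c) => ∫ u : ↥(unipotentRadicalGL F c),
        Fn ⟨(m : GL (Fin n) F) * (u : GL (Fin n) F), (standardParabolicGL F c).mul_mem (standardLeviGL_le F c m.2) (unipotentRadicalGL_le F c u.2)⟩ ∂μU) ∧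
    HasCompactSupport (fun m : ↥(standardLeviGL F c) => ∫ u : ↥(unipotentRadicalGL F c),
        Fn ⟨(m : GL (Fin n) F) * (u : GL (Fin n) F), (standardParabolicGL F c).mul_mem (standardLeviGL_le F c m.2) (unipotentRadicalGL_le F c u.2)⟩ ∂μU) ∧
    (Representation.twist (σ.comp (leviProjection F c)) (rootDeltaChar (standardParabolicGL F c))).smoothTrace μP Fn =
      (Representation.twist (σ.comp ((leviProjection F c).comp (Subgroup.inclusion (standardLeviGL_le F c))))
          ((rootDeltaChar (standardParabolicGL F c)).comp (Subgroup.inclusion (standardLeviGL_le F c)))).smoothTrace νM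
        (fun m : ↥(standardLeviGL F c) => ∫ u : ↥(unipotentRadicalGL F c),
          Fn ⟨(m : GL (Fin n) F) * (u : GL (Fin n) F), (standardParabolicGL F c).mul_mem (standardLeviGL_le F c m.2) (unipotentRadicalGL_le F c u.2)⟩ ∂μU) := by
  classical
  -- frame
  haveI : IsTopologicalRing F := inferInstance
  haveI : T2Space F := (isLocalField F).toT2Space
  haveI : LocallyCompactSpace F := (isLocalField F).toLocallyCompactSpace
  haveI : SecondCountableTopology F := secondCountableTopology_localField F
  haveI : SecondCountableTopology (Matrix (Fin n) (Fin n) F) := inferInstanceAs (SecondCountableTopology (Fin n → Fin n → F))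
  haveI : SecondCountableTopology (Matrix (Fin n) (Fin n) F)ᵐᵒᵖ := MulOpposite.opHomeomorph.symm.secondCountableTopology
  haveI : SecondCountableTopology (GL (Fin n) F) := Units.isEmbedding_embedProduct.secondCountableTopology
  haveI : LocallyCompactSpace (Matrix (Fin n) (Fin n) F) := inferInstanceAs (LocallyCompactSpace (Fin n → Fin n → F))
  haveI : LocallyCompactSpace (GL (Fin n) F) := inferInstance
  have hPcl : IsClosed (standardParabolicGL F c : Set (GL (Fin n) F)) := isClosed_standardParabolicGL F c
  have hMcl : IsClosed (standardLeviGL F c : Set (GL (Fin n) F)) := isClosed_standardLeviGL (R := F) c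
  have hUcl : IsClosed (unipotentRadicalGL F c : Set (GL (Fin n) F)) := isClosed_unipotentRadicalGL (R := F) c
  haveI : SecondCountableTopology ↥(unipotentRadicalGL F c) := inferInstanceAs (SecondCountableTopology ↥((unipotentRadicalGL F c : Set (GL (Fin n) F))))
  haveI : LocallyCompactSpace ↥(unipotentRadicalGL F c) := hUcl.locallyCompactSpace
  -- the representations
  set τ : Representation ℂ ↥(standardParabolicGL F c) W :=
    Representation.twist (σ.comp (leviProjection F c)) (rootDeltaChar (standardParabolicGL F c)) with hτdef
  set σ' : Representation ℂ ↥(standardLeviGL F c) W :=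
    Representation.twist (σ.comp ((leviProjection F c).comp (Subgroup.inclusion (standardLeviGL_le F c))))
      ((rootDeltaChar (standardParabolicGL F c)).comp (Subgroup.inclusion (standardLeviGL_le F c))) with hσ'def
  have hτ : τ.IsAdmissible := isAdmissible_twist_comp_leviProjection F c hσ
  have hσ'adm : σ'.IsAdmissible := isAdmissible_comp_inclusion_levi F c hσ
  have hσ' : ∀ m : ↥(standardLeviGL F c), σ' m = τ (Subgroup.inclusion (standardLeviGL_le F c) m) := fun m => rfl
  -- `σ_P` is trivial on `U_c`
  have huP : ∀ u : ↥(unipotentRadicalGL F c), Subgroup.inclusion (unipotentRadicalGL_le F c) u ∈ unipotentRadicalP F c := fun u => by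
    rw [← unipotentRadicalGL_subgroupOf]
    exact Subgroup.mem_subgroupOf.2 u.2
  have hτU : ∀ u : ↥(unipotentRadicalGL F c), τ (Subgroup.inclusion (unipotentRadicalGL_le F c) u) = 1 := by
    intro u
    refine LinearMap.ext fun w => ?_
    rw [hτdef, twist_apply, MonoidHom.comp_apply, (MonoidHom.mem_ker).1 (huP u), map_one,
      rootDeltaChar_eq_one_of_mem_unipotentRadicalP (F := F) c (huP u), Units.val_one, one_smul, Module.End.one_apply]
  -- `M_c` normalises `U_c`
  have hconjU : ∀ (p : ↥(standardParabolicGL F c)) (u : ↥(unipotentRadicalGL F c)),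
      (p : GL (Fin n) F) * (u : GL (Fin n) F) * (p : GL (Fin n) F)⁻¹ ∈ unipotentRadicalGL F c := by
    intro p u
    have h := (inferInstance : (unipotentRadicalP F c).Normal).conj_mem _ (huP u) p
    exact ⟨_, h, rfl⟩
  have hMU : ∀ (m : ↥(standardLeviGL F c)) (u : ↥(unipotentRadicalGL F c)),
      (m : GL (Fin n) F) * (u : GL (Fin n) F) * (m : GL (Fin n) F)⁻¹ ∈ unipotentRadicalGL F c :=
    fun m u => hconjU (Subgroup.inclusion (standardLeviGL_le F c) m) u
  -- `M_c × U_c ≃ₜ P_c`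
  obtain ⟨e, he⟩ := exists_homeomorph_levi_prod_unipotent_coe_eq F c
  -- the product-form level `L = (P_c ∩ K₁) ∩ ℓ⁻¹(K₁)`
  set ℓ : ↥(standardParabolicGL F c) →* GL (Fin n) F :=
    (standardParabolicGL F c).subtype.comp ((leviEmbeddingP F c).comp (leviProjection F c)) with hℓ
  have hℓc : Continuous ℓ := continuous_subtype_val.comp ((continuous_leviEmbeddingP F c).comp (continuous_leviProjection F c))
  set L : Subgroup ↥(standardParabolicGL F c) := K₁.comap (standardParabolicGL F c).subtype ⊓ K₁.comap ℓ with hLdef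
  have hLo : IsOpen (L : Set ↥(standardParabolicGL F c)) := hFK₁.isOpen.inter (hK₁o.preimage hℓc)
  have hLc : IsCompact (L : Set ↥(standardParabolicGL F c)) :=
    hFK₁.isCompact.of_isClosed_subset (Subgroup.isClosed_of_isOpen _ hLo) fun x hx => hx.1
  have hL : IsLevel L Fn := hFK₁.mono inf_le_left hLo hLc
  have hLprod : ∀ l ∈ L, ∃ m : ↥(standardLeviGL F c), ∃ u : ↥(unipotentRadicalGL F c),
      Subgroup.inclusion (standardLeviGL_le F c) m ∈ L ∧ (l : GL (Fin n) F) = (m : GL (Fin n) F) * (u : GL (Fin n) F) := by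
    intro l hl
    set x := leviProjection F c l with hx
    refine ⟨⟨(leviEmbeddingP F c x : GL (Fin n) F), ⟨x, rfl⟩⟩, ⟨(((leviEmbeddingP F c x)⁻¹ * l : ↥(standardParabolicGL F c)) : GL (Fin n) F),
      ⟨_, leviEmbeddingP_inv_mul_mem_unipotentRadicalP l, rfl⟩⟩, ?_, ?_⟩
    · have hincl : Subgroup.inclusion (standardLeviGL_le F c) ⟨(leviEmbeddingP F c x : GL (Fin n) F), ⟨x, rfl⟩⟩ = leviEmbeddingP F c x :=
        Subtype.ext rfl
      rw [hincl]
      have h2 : ℓ l ∈ K₁ := hl.2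
      refine ⟨h2, ?_⟩
      change ℓ (leviEmbeddingP F c x) ∈ K₁
      rw [hℓ, MonoidHom.comp_apply, MonoidHom.comp_apply, leviProjection_leviEmbeddingP_apply]
      exact h2
    · rw [Subgroup.coe_mul, Subgroup.coe_inv, mul_inv_cancel_left]
  -- the `M`-part of the level: compact open in `M_c`
  have hic : Continuous (Subgroup.inclusion (standardLeviGL_le F c)) := continuous_induced_rng.2 continuous_subtype_val
  have hLMo : IsOpen ((L.comap (Subgroup.inclusion (standardLeviGL_le F c)) : Subgroup ↥(standardLeviGL F c)) : Set ↥(standardLeviGL F c)) :=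
    hLo.preimage hic
  have hLMc : IsCompact ((L.comap (Subgroup.inclusion (standardLeviGL_le F c)) : Subgroup ↥(standardLeviGL F c)) : Set ↥(standardLeviGL F c)) := by
    have hK : IsCompact (Subtype.val ⁻¹' (K₁ : Set (GL (Fin n) F)) : Set ↥(standardLeviGL F c)) := hMcl.isClosedEmbedding_subtypeVal.isCompact_preimage hK₁c
    have hcl : IsClosed ((L.comap (Subgroup.inclusion (standardLeviGL_le F c)) : Subgroup ↥(standardLeviGL F c)) : Set ↥(standardLeviGL F c)) :=
      Subgroup.isClosed_of_isOpen _ hLMo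
    exact hK.of_isClosed_subset hcl fun m hm => (Subgroup.mem_comap.1 hm).1
  -- `Ad(L ∩ M_c)`-invariance of `μ_U` (§1)
  have hμU : ∀ m₀ : ↥(standardLeviGL F c), Subgroup.inclusion (standardLeviGL_le F c) m₀ ∈ L → ∀ g : ↥(unipotentRadicalGL F c) → ℂ, Continuous g →
      ∫ u, g ⟨(m₀ : GL (Fin n) F) * (u : GL (Fin n) F) * (m₀ : GL (Fin n) F)⁻¹, hMU m₀ u⟩ ∂μU = ∫ u, g u ∂μU := by
    intro m₀ hm₀ g _
    have hm₀K : (m₀ : GL (Fin n) F) ∈ K₁ := (Subgroup.mem_comap.1 (Subgroup.mem_inf.1 hm₀).1)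
    have hmU' : ∀ u : ↥(unipotentRadicalGL F c), (m₀ : GL (Fin n) F)⁻¹ * (u : GL (Fin n) F) * (m₀ : GL (Fin n) F) ∈ unipotentRadicalGL F c := fun u => by
      have h := hconjU (Subgroup.inclusion (standardLeviGL_le F c) m₀)⁻¹ u
      simpa only [Subgroup.coe_inv, inv_inv, Subgroup.coe_inclusion] using h
    exact integral_comp_conj_eq_of_mem μU hUcl hK₁o hK₁c hm₀K (hMU m₀) hmU' g
  -- ★ (vD-σ-MU)
  have hFcont : Continuous Fn := hFlc.continuous
  refine ⟨(isLevel_fibreIntegral (standardLeviGL_le F c) (unipotentRadicalGL_le F c) μU hMU hL hFcont hLMo hLMc hμU).isLocallyConstant,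
    hasCompactSupport_fibreIntegral (standardLeviGL_le F c) (unipotentRadicalGL_le F c) μU e (fun m u => he (m, u)) hFc, ?_⟩
  exact smoothTrace_eq_smoothTrace_fibreIntegral (standardLeviGL_le F c) (unipotentRadicalGL_le F c) τ μP νM μU hPint hτ σ' hσ'adm hσ' hτU hMU
    e (fun m u => he (m, u)) hFlc hFc hL hLprod hLMo hLMc hμU

end Main

end Summit.HodgeConjecture.HodgeConjecture.Cruxes.H413.K2E3ParabolicCharacterLeviUnipotentGL

end
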